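import Summits.BirchSwinnertonDyer.BirchSwinnertonDyer.Theorems.Rank1ResidualJetCompatibleData
import Literature.NumberTheory.EllipticCurves.HeegnerPointsOfConductorRationalityProofs
import HarnessLib

/-!
# T1 JET (cell `bsd-jet`), road K: COMPATIBLE Kolyvagin–Heegner data GOING DOWN — a given datum at a
# square-free conductor `n` restricts to a compatible datum at ANY divisor `m ∣ n`

HONEST FRAMING (programme file §HONESTY, verbatim): «no tranche here proves BSD; ARM L moves the
LITERAL column of an r ≤ 1 census into the kernel-proved-modulo-named-print column.» THEOREMS ONLY
(seat `bsd-jet-pv-1`, session g8; `--supports stmt-BirchSwinnertonDyer-14418`, helper); 0 classes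
move; plumbing for the road-K strike of McCallum 1991 Prop. 5.2 (seat `bsd-jet-pv-2` g6, Kolyvagin's
prime-SWAP step `n ↦ n·ℓ'/ℓ₀`, which needs a datum at `n·ℓ'` compatible DOWN to both `n` and
`n·ℓ'/ℓ₀` — the tree had only the UP construction).

WHAT THIS FILE DOES. pv-2's `JET.exists_compatible_datum_mul` (`Rank1ResidualJetCompatibleData.lean`,
p496827) EXTENDS a datum at `c` to a compatible datum at `cℓ` (McCallum's / Gross's ONE system of
choices `σ_l`, `S`, `K_n ⊂ K̄` read at two levels: the four clauses `hσ`, `hS`, `hS'`, `hemb` of the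
typed McCallum Prop. 4.4 `McCallum1991.prop44_localOrder_kolyvaginClass_mul_eq`). Here the converse
direction: `exists_compatible_datum_of_dvd` RESTRICTS a datum `d'` at a square-free `n` (inert prime
factors) to a datum `d` at any divisor `m ∣ n`, compatible in the SAME four clauses (small datum `d`,
big datum `d'`), given the CM input point `y(m) ∈ E(K[m])`; `exists_compatible_datum_of_dvd_of_grossCM`
supplies that point from the Gross §3 CM fact (a theorem of the tree,
`phi_heegnerPointOfConductor_mem_range_map_ringClassField_holds`). Construction (x11b3's ring class
tower at the top level `n`, `RingClassTower.exists_coherent_towerData`, UNCONDITIONAL): with the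
restriction `res_m : 𝒢_n → 𝒢_m` and top generators `g_q`, the given generator is `d'.σ_q = g_q^{a_q}`
with `a_q` invertible mod `q + 1` (`KolyvaginChoice.exists_pow_eq_of_zpowers_eq`), so
`σ_q := res_m(d'.σ_q) = res_m(g_q)^{a_q}` generates `G_q(m)`; `S := res_m(d'.S)` is a transversal of
`G_m` in `𝒢_m` (`res` is onto and detects `Gal(·/K[1])` both ways,
`RingClassTower.exists_restrictHom_eq` ∕ `restrictHom_mem_ringClassGalOver` ∕
`mem_ringClassGalOver_of_restrictHom_mem`); `emb := d'.emb ∘ (K[m] ⊆ K[n])`.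
References: [cite: GrossLMS1991, §3 (pp. 238–239: G_n ≃ ∏ G_ℓ, σ_ℓ), §4 (4.1) (S)]
[cite: McCallumLMS1991, §4 (p. 300: σ_l, S, P_n), Prop. 4.4 (p. 301), §5 (pp. 305–306: the swap n ↦ nℓ'/ℓ₀)]
[cite: Jetchev2008, §4.1 (p. 818)].
-/

set_option autoImplicit false

noncomputable section

open scoped Classical

open WeierstrassCurve Field NumberField IsDedekindDomain
  Literature.NumberTheory.EllipticCurves Literature.NumberTheory.EllipticCurves.ModularForms
  Literature.NumberTheory.EllipticCurves.RingClassField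
  Summit.BirchSwinnertonDyer.Rank1Residual.X11b

namespace Summit.BirchSwinnertonDyer.Rank1Residual.JET

-- `K : Type`: the tree's ring-class class field theory is universe `0`.
variable {K : Type} [Field K] [NumberField K] {N : ℕ} [NeZero N] {W : WeierstrassCurve ℚ}

/-- **Compatible Kolyvagin–Heegner data at a divisor `m ∣ n` RESTRICTING a datum at `n`** (Gross 1991
§3–§4 / McCallum 1991 §4: one coherent system of choices `σ_l`, `S`, `K_n ⊂ K̄`, read at the levels
`m ∣ n`). For `K` imaginary quadratic with `d_K < −4`, a frame `(Dt, β, ι)`, a square-free conductor `n`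
all of whose prime factors are inert in `K`, ANY datum `d'` of conductor `n`, any divisor `m ∣ n`, and
a point `y ∈ E(K[m])` over `φ(x(m))` (the CM input), there is a datum `d` of conductor `m` with
`d.y = y` to which `d'` is compatible in the four clauses of `McCallum1991.prop44_localOrder_kolyvaginClass_mul_eq`
(generators restrict, `hσ`; transversals correspond both ways, `hS`, `hS'`; embeddings into `K̄` agree,
`hemb`) — the DOWN direction of `exists_compatible_datum_mul`. [cite: GrossLMS1991, §3 (pp. 238–239), §4 (4.1)]
[cite: McCallumLMS1991, §4 (p. 300), Prop. 4.4 (p. 301), §5 (pp. 305–306)] -/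
theorem exists_compatible_datum_of_dvd (hK : IsImaginaryQuadratic K) (hD : NumberField.discr K < -4)
    (ι : K →+* ℂ) (Dt : ModularParametrizationData W N) {β : ℤ}
    {n m : ℕ} (hn : Squarefree n) (hmn : m ∣ n)
    (hinert : ∀ q ∈ n.primeFactors, (Ideal.span {(q : 𝓞 K)}).IsPrime)
    (d' : KolyvaginHeegnerData Dt β ι n)
    (y : (W.baseChange (ringClassField K ι m)).toAffine.Point)
    (hy : WeierstrassCurve.Affine.Point.map (ringClassField K ι m).subtype.toRatAlgHom y =
      heegnerPointComplexOfConductor Dt (NumberField.discr K) β m) :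
    ∃ d : KolyvaginHeegnerData Dt β ι m, d.y = y ∧
      (∀ l' ∈ m.primeFactors, ∀ (x : ringClassField K ι m) (x' : ringClassField K ι n),
        (x : ℂ) = x' → ((d'.σ l' x' : ringClassField K ι n) : ℂ) = (d.σ l' x : ℂ)) ∧
      (∀ s ∈ d.S, ∃ s' ∈ d'.S, ∀ (x : ringClassField K ι m) (x' : ringClassField K ι n),
        (x : ℂ) = x' → ((s' x' : ringClassField K ι n) : ℂ) = (s x : ℂ)) ∧
      (∀ s' ∈ d'.S, ∃ s ∈ d.S, ∀ (x : ringClassField K ι m) (x' : ringClassField K ι n),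
        (x : ℂ) = x' → ((s' x' : ringClassField K ι n) : ℂ) = (s x : ℂ)) ∧
      (∀ (x : ringClassField K ι m) (x' : ringClassField K ι n),
        (x : ℂ) = x' → d'.emb x' = d.emb x) := by
  -- elementary facts
  have hn0 : n ≠ 0 := hn.ne_zero
  have hm0 : m ≠ 0 := fun h ↦ hn0 (Nat.eq_zero_of_zero_dvd (h ▸ hmn))
  have hmsq : Squarefree m := hn.squarefree_of_dvd hmn
  have hle : ringClassField K ι m ≤ ringClassField K ι n := ringClassField_mono hK ι hmn hn0
  have h1le : ringClassField K ι 1 ≤ ringClassField K ι m := ringClassField_mono hK ι (one_dvd m) hm0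
  have hpf : ∀ q ∈ m.primeFactors, q ∈ n.primeFactors := fun q hq ↦ Nat.primeFactors_mono hmn hn0 hq
  -- x11b3's coherent tower at the top level `n`: restriction homs and generators
  obtain ⟨res, g, -, h1, h2, h3, h4, -⟩ := RingClassTower.exists_coherent_towerData hK ι hn hinert
  have hr := h1 m hmn
  -- the given generators as elements of `𝒢_n`
  have hσmem : ∀ q ∈ n.primeFactors, d'.σ q ∈ ringClassGal ι n := fun q hq ↦
    ringClassGalOver_le_ringClassGal ι n (n / q) ((d'.zpowers_σ q hq) ▸ Subgroup.mem_zpowers (d'.σ q))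
  let t : ℕ → ringClassGal ι n := fun q ↦ if hq : q ∈ n.primeFactors then ⟨d'.σ q, hσmem q hq⟩ else 1
  have ht : ∀ q ∈ n.primeFactors,
      (t q : ringClassField K ι n ≃ₐ[ℚ] ringClassField K ι n) = d'.σ q := fun q hq ↦ by
    simp only [t, dif_pos hq]
  -- (σ) for `q ∣ n`: `d'.σ q = g q ^ a q` with `a q` invertible mod `q + 1`
  have hpow : ∀ q ∈ n.primeFactors, ∃ a b : ℕ, t q = g q ^ a ∧ a * b % (q + 1) = 1 := by
    intro q hq
    have hqp : q.Prime := Nat.prime_of_mem_primeFactors hq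
    have hqn : q ∣ n := Nat.dvd_of_mem_primeFactors hq
    have hndvd : ¬ q ∣ n / q := fun h ↦ by
      have : q * q ∣ n := by
        have := Nat.mul_dvd_mul_left q h
        rwa [Nat.mul_div_cancel' hqn] at this
      exact hqp.one_lt.ne' (Nat.isUnit_iff.mp (hn q this))
    have hgq : Subgroup.zpowers (g q : ringClassField K ι n ≃ₐ[ℚ] ringClassField K ι n) =
        ringClassGalOver ι n (n / q) := by
      have h := (h4 n dvd_rfl q hq).1
      rwa [h2 (g q)] at h
    have hord : orderOf (g q : ringClassField K ι n ≃ₐ[ℚ] ringClassField K ι n) = q + 1 :=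
      RingClassTower.orderOf_eq_succ_of_zpowers_eq_ringClassGalOver hK ι hqp (hinert q hq) hqn hndvd hn0
        (Or.inr hD) hgq
    have hordt : orderOf (g q) = q + 1 := by rw [← Subgroup.orderOf_coe]; exact hord
    have hz : Subgroup.zpowers (t q) = Subgroup.zpowers (g q) := by
      apply Subgroup.map_injective (Subgroup.subtype_injective (ringClassGal ι n))
      rw [MonoidHom.map_zpowers, MonoidHom.map_zpowers]
      change Subgroup.zpowers (t q : ringClassField K ι n ≃ₐ[ℚ] ringClassField K ι n) =
        Subgroup.zpowers (g q : ringClassField K ι n ≃ₐ[ℚ] ringClassField K ι n)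
      rw [ht q hq, d'.zpowers_σ q hq, hgq]
    exact KolyvaginChoice.exists_pow_eq_of_zpowers_eq hqp.ne_zero hordt hz
  choose! a b ha hab using hpow
  -- the generators at level `m`
  let σ : ℕ → (ringClassField K ι m ≃ₐ[ℚ] ringClassField K ι m) := fun q ↦ res m (t q)
  have hσz : ∀ q ∈ m.primeFactors, Subgroup.zpowers (σ q) = ringClassGalOver ι m (m / q) := by
    intro q hq
    have hqn : q ∈ n.primeFactors := hpf q hq
    change Subgroup.zpowers (res m (t q)) = _
    rw [ha q hqn, map_pow, zpowers_pow_eq_of_mul_mod_eq_one (h4 m hmn q hq).2 (hab q hqn)]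
    exact (h4 m hmn q hq).1
  -- (S) restrictions of `d'.S` along `res`
  let lift : (ringClassField K ι n ≃ₐ[ℚ] ringClassField K ι n) → ringClassGal ι n := fun s ↦
    if hs : s ∈ ringClassGal ι n then ⟨s, hs⟩ else 1
  have hlift : ∀ s ∈ d'.S, (lift s : ringClassField K ι n ≃ₐ[ℚ] ringClassField K ι n) = s :=
    fun s hs ↦ by simp only [lift, dif_pos (d'.S_subset s hs)]
  let S : Finset (ringClassField K ι m ≃ₐ[ℚ] ringClassField K ι m) := d'.S.image fun s ↦ res m (lift s)
  -- (emb) restrict `d'.emb` along `K[m] ⊆ K[n]`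
  let e : ringClassField K ι m →+* AlgebraicClosure K :=
    d'.emb.comp (RingClassField.inclusion ι hle).toRingHom
  have hincl : ∀ (x : ringClassField K ι m) (x' : ringClassField K ι n), (x : ℂ) = x' →
      x' = RingClassField.inclusion ι hle x := fun x x' hxx' ↦
    Subtype.ext (by rw [RingClassField.coe_inclusion]; exact hxx'.symm)
  -- the datum
  refine ⟨{ dvd_sq_sub := d'.dvd_sq_sub
            y := y
            map_y := hy
            σ := σ
            zpowers_σ := hσz
            S := S
            S_subset := ?_
            S_transversal := ?_
            emb := e
            emb_apply := ?_ }, rfl, ?_, ?_, ?_, ?_⟩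
  · -- `S ⊆ 𝒢_m`
    intro s hs
    obtain ⟨s₀, -, rfl⟩ := Finset.mem_image.mp hs
    exact h3 m hmn (lift s₀)
  · -- `S` is a transversal of `G_m = Gal(K[m]/K[1])` in `𝒢_m`
    intro G hG
    obtain ⟨Gg, hGg⟩ := RingClassTower.exists_restrictHom_eq hK ι hmn hn0 hr hG
    obtain ⟨s', ⟨hs'S, hs'1⟩, huniq⟩ := d'.S_transversal (Gg : ringClassField K ι n ≃ₐ[ℚ] _) Gg.2
    have hls' : (lift s' : ringClassField K ι n ≃ₐ[ℚ] ringClassField K ι n) = s' := hlift s' hs'S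
    refine ⟨res m (lift s'), ⟨Finset.mem_image.mpr ⟨s', hs'S, rfl⟩, ?_⟩, ?_⟩
    · have hmem : ((Gg⁻¹ * lift s' : ringClassGal ι n) :
          ringClassField K ι n ≃ₐ[ℚ] ringClassField K ι n) ∈ ringClassGalOver ι n 1 := by
        simpa [hls'] using hs'1
      have h := RingClassTower.restrictHom_mem_ringClassGalOver hK ι hmn hn0 hr (Gg⁻¹ * lift s') hmem
      rwa [map_mul, map_inv, hGg] at h
    · rintro s'' ⟨hs''S, hs''1⟩
      obtain ⟨s₂, hs₂S, rfl⟩ := Finset.mem_image.mp hs''S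
      have hls₂ : (lift s₂ : ringClassField K ι n ≃ₐ[ℚ] ringClassField K ι n) = s₂ := hlift s₂ hs₂S
      have hmem : res m (Gg⁻¹ * lift s₂) ∈ ringClassGalOver ι m 1 := by
        rw [map_mul, map_inv, hGg]; exact hs''1
      have h := RingClassTower.mem_ringClassGalOver_of_restrictHom_mem ι hr h1le (Gg⁻¹ * lift s₂) hmem
      have h' : (Gg : ringClassField K ι n ≃ₐ[ℚ] _)⁻¹ * s₂ ∈ ringClassGalOver ι n 1 := by
        simpa [hls₂] using h
      rw [huniq s₂ ⟨hs₂S, h'⟩]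
  · -- `emb` is the identity on `K`
    intro k
    change d'.emb (RingClassField.inclusion ι hle (algebraMap K (ringClassField K ι m) k)) = _
    rw [(RingClassField.inclusion ι hle).commutes k, d'.emb_apply]
  · -- `hσ`
    intro l' hl' x x' hxx'
    change _ = ((res m (t l') x : ringClassField K ι m) : ℂ)
    rw [hr (t l') x x' hxx', ht l' (hpf l' hl')]
  · -- `hS`
    intro s hs
    obtain ⟨s', hs', rfl⟩ := Finset.mem_image.mp hs
    refine ⟨s', hs', fun x x' hxx' ↦ ?_⟩
    rw [hr (lift s') x x' hxx', hlift s' hs']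
  · -- `hS'`
    intro s' hs'
    refine ⟨res m (lift s'), Finset.mem_image.mpr ⟨s', hs', rfl⟩, fun x x' hxx' ↦ ?_⟩
    rw [hr (lift s') x x' hxx', hlift s' hs']
  · -- `hemb`
    intro x x' hxx'
    rw [hincl x x' hxx']
    rfl

/-- **The DOWN-compatible datum, CM input supplied** (Gross 1991 §3: `y(m) ∈ E(K[m])`, the tree's
theorem `phi_heegnerPointOfConductor_mem_range_map_ringClassField_holds`): for `E/ℚ` elliptic, `K`
imaginary quadratic with `d_K < −4` and the Heegner hypothesis for `N`, a frame `(Dt, β, ι)`, a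
square-free conductor `n` whose prime factors are Kolyvagin primes (any `p`), ANY datum `d'` of
conductor `n` and any divisor `m ∣ n`: a datum of conductor `m` to which `d'` is compatible in the four
clauses `hσ`, `hS`, `hS'`, `hemb`. [cite: GrossLMS1991, §3 (pp. 238–239), §4 (4.1)]
[cite: McCallumLMS1991, §4 (p. 300), §5 (pp. 305–306)] -/
theorem exists_compatible_datum_of_dvd_of_grossCM [W.IsElliptic] [W.IsGloballyMinimal]
    (hK : IsImaginaryQuadratic K) (hD : NumberField.discr K < -4) (hH : SatisfiesHeegnerHypothesis N K)
    (p : ℕ) (Dt : ModularParametrizationData W N) (β : ℤ) (ι : K →+* ℂ)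
    {n m : ℕ} (hn : Squarefree n) (hnK : ∀ ℓ ∈ n.primeFactors, Zhang2014.IsKolyvaginPrime N W K p ℓ)
    (hmn : m ∣ n) (d' : KolyvaginHeegnerData Dt β ι n) :
    ∃ d : KolyvaginHeegnerData Dt β ι m,
      (∀ l' ∈ m.primeFactors, ∀ (x : ringClassField K ι m) (x' : ringClassField K ι n),
        (x : ℂ) = x' → ((d'.σ l' x' : ringClassField K ι n) : ℂ) = (d.σ l' x : ℂ)) ∧
      (∀ s ∈ d.S, ∃ s' ∈ d'.S, ∀ (x : ringClassField K ι m) (x' : ringClassField K ι n),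
        (x : ℂ) = x' → ((s' x' : ringClassField K ι n) : ℂ) = (s x : ℂ)) ∧
      (∀ s' ∈ d'.S, ∃ s ∈ d.S, ∀ (x : ringClassField K ι m) (x' : ringClassField K ι n),
        (x : ℂ) = x' → ((s' x' : ringClassField K ι n) : ℂ) = (s x : ℂ)) ∧
      (∀ (x : ringClassField K ι m) (x' : ringClassField K ι n),
        (x : ℂ) = x' → d'.emb x' = d.emb x) := by
  have hn0 : n ≠ 0 := hn.ne_zero
  have hm0 : m ≠ 0 := fun h ↦ hn0 (Nat.eq_zero_of_zero_dvd (h ▸ hmn))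
  have hinert : ∀ q ∈ n.primeFactors, (Ideal.span {(q : 𝓞 K)}).IsPrime := fun q hq ↦ (hnK q hq).2.2.2.2.1
  have hinertm : ∀ q ∈ m.primeFactors, (Ideal.span {(q : 𝓞 K)}).IsPrime := fun q hq ↦
    hinert q (Nat.primeFactors_mono hmn hn0 hq)
  obtain ⟨y, hy⟩ := phi_heegnerPointOfConductor_mem_range_map_ringClassField_holds N W K hK hH Dt β ι m
    d'.dvd_sq_sub hm0 (BirchSwinnertonDyer.Theorems.coprime_of_primeFactors_inert hH hm0 hinertm)
  obtain ⟨d, -, hσ, hS, hS', hemb⟩ := exists_compatible_datum_of_dvd hK hD ι Dt hn hmn hinert d' y hy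
  exact ⟨d, hσ, hS, hS', hemb⟩

end Summit.BirchSwinnertonDyer.Rank1Residual.JET

end
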